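import Literature.MathematicalPhysics.QuantumFieldTheory.OSMeanValueIdentity
import Literature.Analysis.Distribution.RadialKernelMass
import Literature.Analysis.Distribution.RayBoundaryValueGrowth
import HarnessLib

/-!
# The pointwise bound of a Schwinger function by the mean value over a polydisc (OS II, Ch. VI.1 (6.5)–(6.13))

Topic `Literature/MathematicalPhysics/QuantumFieldTheory`; support file (all proved; no definitions
beyond abbreviations inside proofs; no named facts): **the mean-value step of
Osterwalder–Schrader II, Ch. VI.1 with explicit constants.** For a local holomorphic density `S` of
`𝔖_{k+2}` on `ball (cfgPt x) ρ` (as produced by `OSDensityNearRadius`) and skeleton data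
`(ξ, ê, g)` at `x`, the value `S(cfgPt x)` is the exact average of `S` over the polydisc in the
frame directions of every point against the product radial kernel `∏ β(|w_p|² − r₁)` of mass `π`
per factor (`integral_pi_radial_smul_eq_smul`, `RadialKernelMass`); slicing in the imaginary
parts `v` (`reImEquiv`), each real slice is the smeared density `Θ_v` of `OSMeanValueIdentity` at
the tube point `ζ_v = cfgPt x + i cfgPt(frameMap∘v)`, which equals the sector extension `Γ_v(ζ_v)`
of the skeleton and is bounded by `norm_geomG_le`. Result (`norm_density_le_meanValue`):

  `‖S(cfgPt x)‖ ≤ π^{-N} (2√(2r₁))^N · e^{2b(K+1)(logRadius + π/4)²} · geomProf · unitSlotBmaxW · unitTubeConstW(π/4)`,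

`N = (k+2)d`, with the geometric profile constant of the frame profiles — every factor explicit.

## References

* K. Osterwalder, R. Schrader, *Axioms for Euclidean Green's functions II*, Comm. Math. Phys. 42
  (1975) 281–305, Ch. VI.1 (6.5)–(6.13). [OsterwalderSchraderCMP1975]
-/

noncomputable section

open MeasureTheory Complex Set Metric Filter
open _root_.Topology
open scoped InnerProductSpace RealInnerProductSpace SchwartzMap NNReal Real

namespace Literature.MathematicalPhysics.QuantumFieldTheory

open Literature.MathematicalPhysics.QuantumLattice (SchwingerFamily IsPositiveTimeMulti schwartzNorm)
open Literature.MathematicalPhysics.QuantumLattice.SchwingerFamily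
open Literature.MathematicalPhysics.QuantumLattice.SchwingerFamily.OSSpace
open Literature.Analysis.FunctionSpaces.SchwartzAverage
open Literature.Analysis.Distribution
open Literature.Analysis.Complex
open OSFrames

variable {d : ℕ} [NeZero d]

/-! ### Kernel algebra -/

section KernelAlgebra

variable {k : ℕ} (n₀ : ℕ) {r₁ : ℝ} (hr₁ : 0 < r₁)

omit [NeZero d] in
/-- The blocks of a flat vector: `vb v j μ = v (finProdFinEquiv (j, μ))`. [folklore] -/
def vblocks (v : Fin ((k + 2) * d) → ℝ) : Fin (k + 2) → Fin d → ℝ := fun j μ => v (finProdFinEquiv (j, μ))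

omit [NeZero d] in
/-- **The product of the radial kernels at `u + iv` is the product kernel of the slices at the flat
configuration of `u`.** [folklore] -/
theorem prod_radialKernel_eq_prodKer (u v : Fin ((k + 2) * d) → ℝ) :
    ((∏ p, radialKernel n₀ r₁ ‖(⟨u p, v p⟩ : ℂ)‖ : ℝ) : ℂ) = prodKer (k := k) n₀ hr₁ (vblocks v) (ucfg u) := by
  simp only [prodKer, prodProfile_apply, ucfg_apply, vblocks, radialKernel_norm_mk]
  push_cast
  rw [← Equiv.prod_comp (finProdFinEquiv : Fin (k + 2) × Fin d ≃ Fin ((k + 2) * d)), Fintype.prod_prod_type]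

end KernelAlgebra

/-! ### The bound -/

section Bound

variable (𝔖 : SchwingerFamily (EuclideanSpace ℝ (Fin d))) (hE2 : 𝔖.IsOSReflectionPositive) {k : ℕ}
  (ξ : Fin (k + 1) → EuclideanSpace ℝ (Fin d)) (ê : Fin d → EuclideanSpace ℝ (Fin d)) (hli : LinearIndependent ℝ ê) {g r₀ : ℝ}
  {b : ℝ} (hb : 0 < b) (hE1 : 𝔖.IsEuclideanCovariant)
  (hê1 : ∀ μ, ‖ê μ‖ = 1) (hêê : ∀ μ ν, 0 ≤ ⟪ê μ, ê ν⟫) (hξ : ∀ μ i', g ≤ ⟪ê μ, ξ i'⟫)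
  (hg : 2 * r₀ < g) (hr₀ : 0 ≤ r₀)
  {s : ℕ} {Cv : ℕ → ℝ} (hCv : ∀ n, 0 ≤ Cv n)
  (hv : ∀ (n : ℕ) (K : 𝓢((Fin n → EuclideanSpace ℝ (Fin d)), ℂ)) (hK : IsPositiveTimeMulti K),
    ‖ι 𝔖 hE2 (δ 𝔖 hE2 (mkGen K hK))‖ ≤ Cv n * schwartzNorm ((n + n) * s) K)
  {M : ℕ} (hM : (k + 1 + (k + 1)) * s ≤ M)
  {s₀ : ℕ} {C₀ : ℝ} (hC₀ : 0 ≤ C₀)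
  (hσ : ∀ F : 𝓢((Fin (k + 2) → EuclideanSpace ℝ (Fin d)), ℂ), ‖𝔖 (k + 2) F‖ ≤ C₀ * schwartzNorm s₀ F)
  {r₁ : ℝ} (hr₁ : 0 < r₁) (hr₁1 : r₁ ≤ 1)
  {x : Fin (k + 2) → EuclideanSpace ℝ (Fin d)} {ρ ρ₂ : ℝ} {S : (Fin (k + 2) → Fin d → ℂ) → ℂ}
  (hSd : DifferentiableOn ℂ S (ball (cfgPt x) ρ)) {Bs : ℝ} (hSB : ∀ ζ ∈ ball (cfgPt x) ρ, ‖S ζ‖ ≤ Bs)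
  (hSrep : ∀ F : 𝓢((Fin (k + 2) → EuclideanSpace ℝ (Fin d)), ℂ),
    tsupport (F : (Fin (k + 2) → EuclideanSpace ℝ (Fin d)) → ℂ) ⊆ Metric.ball x ρ → 𝔖 (k + 2) F = ∫ y, S (cfgPt y) * F y)
  (hρ₂ : 0 < ρ₂)
  (hr₀eq : ‖(frameMap ê hli : EuclideanSpace ℝ (Fin d) →L[ℝ] EuclideanSpace ℝ (Fin d))‖ * Real.sqrt (2 * d * r₁) ≤ r₀)
  (hρρ : ρ₂ + r₀ < ρ)
  {rt : ℝ} (hrt : ∀ j, rt ≤ tailR ((posLinCLE (k := k) ê hli).symm (x - pbase ξ)) j * Real.sin (π / (4 * (slotK k d + 1))))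
  (hLρ : max ‖((posLinCLE (k := k) ê hli).symm.toContinuousLinearMap)‖
      (cplxLBound ((posLinCLE (k := k) ê hli).symm.toContinuousLinearMap)) * ρ₂ < rt)
  -- the polydisc fits: `N · 2√(2 r₁) < ρ₂` and `‖frameMap‖ √d √(2 r₁) < ρ₂`
  (hfit : ((k + 2) * d : ℝ) * (2 * Real.sqrt (2 * r₁)) < ρ₂)
  (hfit2 : ‖(frameMap ê hli : EuclideanSpace ℝ (Fin d) →L[ℝ] EuclideanSpace ℝ (Fin d))‖ * Real.sqrt d * Real.sqrt (2 * r₁) < ρ₂)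

include hb hE1 hê1 hêê hξ hg hr₀ hCv hv hM hC₀ hσ hr₁ hr₁1 hSd hSB hSrep hρ₂ hr₀eq hρρ hrt hLρ hfit hfit2

/-- **The mean-value bound** (OS II Ch. VI.1 (6.5)–(6.13), explicit):
`‖S(cfgPt x)‖ ≤ π^{-N} (2√(2r₁))^N e^{2b(K+1)(logRadius+π/4)²} geomProf · unitSlotBmaxW · unitTubeConstW(π/4)`. [cite: OsterwalderSchraderCMP1975, Ch. VI.1 (6.5)–(6.13)] -/
theorem norm_density_le_meanValue :
    ‖S (cfgPt x)‖ ≤ (π ^ ((k + 2) * d))⁻¹ * (2 * Real.sqrt (2 * r₁)) ^ ((k + 2) * d) *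
      (Real.exp (2 * |b| * (slotK k d + 1) * (logRadius (tailR ((posLinCLE (k := k) ê hli).symm (x - pbase ξ))) rt + π / 4) ^ 2) *
        (geomProf k M (frameJac ê hli * (2 * (((M : ℝ) + 1) / r₁)) ^ d)
            (max 1 (‖(frameMap ê hli : EuclideanSpace ℝ (Fin d) →L[ℝ] EuclideanSpace ℝ (Fin d))‖ * (2 * Real.sqrt d)))
            (‖((frameMap ê hli).symm : EuclideanSpace ℝ (Fin d) →L[ℝ] EuclideanSpace ℝ (Fin d))‖ *
              ((d : ℝ) * (6 * ((M : ℝ) + 1) * max 1 (((M : ℝ) + 1) / r₁ * baseDerivL1)))) *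
          unitSlotBmaxW ξ ê g b Cv M * unitTubeConstW b (slotK k d) (π / 4))) := by
  -- abbreviations
  set N : ℕ := (k + 2) * d with hN
  set R₁ : ℝ := Real.sqrt (2 * r₁) with hR₁
  set R : ℝ := 2 * R₁ with hR
  set L := (posLinCLE (k := k) ê hli).symm.toContinuousLinearMap with hL
  set U₀ := (posLinCLE (k := k) ê hli).symm (x - pbase ξ) with hU₀
  set a₁ : ℝ := frameJac ê hli * (2 * (((M : ℝ) + 1) / r₁)) ^ d with ha₁
  set Rφ : ℝ := max 1 (‖(frameMap ê hli : EuclideanSpace ℝ (Fin d) →L[ℝ] EuclideanSpace ℝ (Fin d))‖ * (2 * Real.sqrt d)) with hRφ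
  set B₁ : ℝ := ‖((frameMap ê hli).symm : EuclideanSpace ℝ (Fin d) →L[ℝ] EuclideanSpace ℝ (Fin d))‖ *
    ((d : ℝ) * (6 * ((M : ℝ) + 1) * max 1 (((M : ℝ) + 1) / r₁ * baseDerivL1))) with hB₁
  set GB : ℝ := Real.exp (2 * |b| * (slotK k d + 1) * (logRadius (tailR U₀) rt + π / 4) ^ 2) *
    (geomProf k M a₁ Rφ B₁ * unitSlotBmaxW ξ ê g b Cv M * unitTubeConstW b (slotK k d) (π / 4)) with hGB
  have hR₁0 : 0 < R₁ := Real.sqrt_pos.2 (by positivity)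
  have hR₁R : R₁ < R := by rw [hR]; linarith
  have hrt0 : 0 < rt := rt_pos ê hli hρ₂ hLρ
  have hR1 : (1 : ℝ) ≤ Rφ := le_max_left _ _
  have hB1 : (0 : ℝ) ≤ B₁ := by have := baseDerivL1_nonneg; positivity
  have ha1 : (0 : ℝ) ≤ a₁ := by have := frameJac_nonneg ê hli; positivity
  have hGB0 : 0 ≤ GB := by
    have h1 := geomProf_nonneg k M ha1 hR1 (B := B₁)
    have h2 := unitSlotBmaxW_nonneg ξ ê (g := g) b hCv M
    have h3 := unitTubeConstW_nonneg b (slotK k d) (π / 4)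
    rw [hGB]
    exact mul_nonneg (Real.exp_pos _).le (mul_nonneg (mul_nonneg h1 h2) h3)
  have hR0 : 0 ≤ R := by rw [hR, hR₁]; positivity
  -- the directions and the polydisc
  set vdir : Fin N → (Fin (k + 2) → Fin d → ℂ) := fun p => frameDir ê p with hvdir
  have hmem : ∀ w : Fin N → ℂ, (∀ p, ‖w p‖ ≤ R) → cfgPt x + ∑ p, w p • vdir p ∈ ball (cfgPt x) ρ := by
    intro w hw
    rw [mem_ball, dist_eq_norm, add_sub_cancel_left]
    calc ‖∑ p, w p • vdir p‖ ≤ ∑ p, ‖w p • vdir p‖ := norm_sum_le _ _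
      _ ≤ ∑ _p : Fin N, R := Finset.sum_le_sum fun p _ => by
          rw [norm_smul]
          exact (mul_le_mul (hw p) (norm_frameDir_le ê hê1 p) (norm_nonneg _) hR0).trans (le_of_eq (mul_one _))
      _ = N * R := by simp
      _ < ρ₂ := by rw [hN, hR, hR₁]; push_cast; exact hfit
      _ < ρ := by have := le_trans (by positivity) hr₀eq; linarith
  -- the weighted mean value property
  have hbc : Continuous (radialKernel M r₁) := continuous_radialKernel M r₁
  have hbR : ∀ t, R₁ ≤ t → radialKernel M r₁ t = 0 := fun t ht => radialKernel_eq_zero M hr₁ ht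
  have hmv := Literature.Analysis.Complex.integral_pi_radial_smul_eq_smul hbc hR₁0 hR₁R hbR hSd N (cfgPt x) vdir hmem
  rw [integral_radialKernel_norm M hr₁] at hmv
  have hπN : (0 : ℝ) < π ^ N := by positivity
  have hSx : ‖S (cfgPt x)‖ = (π ^ N)⁻¹ * ‖∫ w : Fin N → ℂ, (∏ p, radialKernel M r₁ ‖w p‖) • S (cfgPt x + ∑ p, w p • vdir p)‖ := by
    rw [hmv, norm_smul, Real.norm_eq_abs, abs_of_pos hπN, ← mul_assoc, inv_mul_cancel₀ hπN.ne', one_mul]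
  -- the integral as an iterated integral
  set G : (Fin N → ℂ) → ℂ := fun w => (∏ p, radialKernel M r₁ ‖w p‖) • S (cfgPt x + ∑ p, w p • vdir p) with hG
  have hGint : Integrable G :=
    (Literature.Analysis.Complex.continuous_prod_radial_smul hbc hR₁R hbR hSd.continuousOn (cfgPt x) vdir hmem).integrable_of_hasCompactSupport
      (Literature.Analysis.Complex.hasCompactSupport_prod_radial_smul hR₁0.le hbR S (cfgPt x) vdir)
  have hΦ := measurePreserving_reImEquiv N
  have hGint' : Integrable (fun p : (Fin N → ℝ) × (Fin N → ℝ) => G ((reImEquiv N).symm p))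
      ((volume : Measure (Fin N → ℝ)).prod volume) :=
    ((hΦ.symm _).integrable_comp_emb (MeasurableEquiv.measurableEmbedding _)).2 hGint
  have hiter : ∫ w, G w = ∫ v : Fin N → ℝ, ∫ u : Fin N → ℝ, G ((reImEquiv N).symm (u, v)) := by
    rw [← (hΦ.symm _).integral_comp', integral_prod_symm _ hGint']
  -- the tube points `ζ_v`
  set ζv : (Fin N → ℝ) → (Fin (k + 2) → Fin d → ℂ) := fun v =>
    cfgPt x + (I : ℂ) • cfgPt (fun j => frameMap ê hli (ucfg v j)) with hζv
  have hζv_mem : ∀ v : Fin N → ℝ, ‖v‖ ≤ R₁ → ζv v ∈ ball (cfgPt x) ρ₂ := by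
    intro v hv
    rw [mem_ball, dist_eq_norm, hζv]
    simp only [add_sub_cancel_left, norm_smul, Complex.norm_I, one_mul]
    calc ‖cfgPt fun j => frameMap ê hli (ucfg v j)‖ ≤ ‖fun j => frameMap ê hli (ucfg v j)‖ := norm_cfgPt_le _
      _ ≤ ‖(frameMap ê hli : EuclideanSpace ℝ (Fin d) →L[ℝ] EuclideanSpace ℝ (Fin d))‖ * Real.sqrt d * R₁ := by
          refine (pi_norm_le_iff_of_nonneg (by positivity)).2 fun j => ?_
          calc ‖frameMap ê hli (ucfg v j)‖ ≤ ‖(frameMap ê hli : EuclideanSpace ℝ (Fin d) →L[ℝ] EuclideanSpace ℝ (Fin d))‖ * ‖ucfg v j‖ :=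
                (frameMap ê hli : EuclideanSpace ℝ (Fin d) →L[ℝ] EuclideanSpace ℝ (Fin d)).le_opNorm _
            _ ≤ ‖(frameMap ê hli : EuclideanSpace ℝ (Fin d) →L[ℝ] EuclideanSpace ℝ (Fin d))‖ * (Real.sqrt d * R₁) :=
                mul_le_mul_of_nonneg_left ((norm_ucfg_le v j).trans (mul_le_mul_of_nonneg_left hv (Real.sqrt_nonneg _))) (norm_nonneg _)
            _ = _ := by ring
      _ < ρ₂ := by rw [hR₁]; exact hfit2
  -- the inner integrals are the values `Θ_v(ζ_v)`
  have hinner : ∀ v : Fin N → ℝ, ∫ u : Fin N → ℝ, G ((reImEquiv N).symm (u, v)) = mvTheta ê hli M hr₁ S (vblocks v) (ζv v) := by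
    intro v
    have hGuv : ∀ u, G ((reImEquiv N).symm (u, v)) =
        (fun c : Fin (k + 2) → EuclideanSpace ℝ (Fin d) => S (ζv v + frameShift ê hli c) * prodKer M hr₁ (vblocks v) c) (ucfg u) := by
      intro u
      rw [reImEquiv_symm_apply]
      simp only [hG, hvdir]
      rw [sum_smul_frameDir_eq ê hli, Complex.real_smul, prod_radialKernel_eq_prodKer M hr₁ u v, mul_comm]
      congr 2
      simp only [hζv, frameShift]
      abel
    simp_rw [hGuv]
    rw [integral_comp_ucfg (fun c : Fin (k + 2) → EuclideanSpace ℝ (Fin d) => S (ζv v + frameShift ê hli c) * prodKer M hr₁ (vblocks v) c)]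
    rfl
  -- bound for the inner integrals
  have hinner_bound : ∀ v : Fin N → ℝ, ‖∫ u : Fin N → ℝ, G ((reImEquiv N).symm (u, v))‖ ≤
      (closedBall (0 : Fin N → ℝ) R₁).indicator (fun _ => GB) v := by
    intro v
    by_cases hvmem : v ∈ closedBall (0 : Fin N → ℝ) R₁
    · rw [indicator_of_mem hvmem, hinner v]
      have hv' : ‖v‖ ≤ R₁ := mem_closedBall_zero_iff.1 hvmem
      have hζ := hζv_mem v hv'
      rw [mvTheta_eq_mvGamma 𝔖 hE2 ξ ê hli hb hE1 hê1 hêê hξ hg hr₀ hCv hv hM hC₀ hσ hr₁ hSd hSB hSrep hρ₂ hr₀eq hρρ hrt hLρ hr₁1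
        (vblocks v) hζ, mvGamma]
      -- the argument of `geomG` lies in the tail ball
      have hcentre : cplxL L (cfgPt x - cfgPt (pbase ξ)) = eRealPt U₀ := by
        rw [← cfgPt_sub, cplxL_cfgPt]; rfl
      have hρA : cplxLBound L * ρ₂ < rt := lt_of_le_of_lt (mul_le_mul_of_nonneg_right (le_max_right _ _) hρ₂.le) hLρ
      have hz : cplxL L (ζv v - cfgPt (pbase ξ)) ∈ ball (eRealPt U₀) rt := by
        rw [← hcentre]; exact cplxL_mem_ball L hζ hρA _
      exact norm_geomG_le 𝔖 hE2 ξ ê hb hE1 hê1 hêê hξ hg hr₀ hCv hv hM hC₀ hσ hR1 hB1 ha1 (frameProfs ê hli M hr₁ (vblocks v))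
        (tsupport_frameProfs_subset ê hli M hr₁ hr₀eq (vblocks v)) (frameProfs_geometric ê hli M hr₁ hr₁1 (vblocks v)) U₀ hrt0 hrt hz
    · rw [indicator_of_notMem hvmem]
      have h0 : ∀ u, G ((reImEquiv N).symm (u, v)) = 0 := by
        intro u
        rw [mem_closedBall_zero_iff, pi_norm_le_iff_of_nonneg hR₁0.le] at hvmem
        push Not at hvmem
        obtain ⟨i, hi⟩ := hvmem
        simp only [hG]
        rw [Literature.Analysis.Complex.prod_radial_eq_zero hbR (i := i) ?_, zero_smul]
        rw [reImEquiv_symm_apply]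
        exact hi.le.trans (by simpa using abs_im_le_norm (⟨u i, v i⟩ : ℂ))
      simp [h0]
  -- integrability of the dominating indicator and the volume of the cube
  have hind : Integrable ((closedBall (0 : Fin N → ℝ) R₁).indicator (fun _ => GB)) (volume : Measure (Fin N → ℝ)) := by
    refine (integrable_indicator_iff measurableSet_closedBall).2 ?_
    exact integrableOn_const (isCompact_closedBall _ _).measure_lt_top.ne
  have hvol : (volume : Measure (Fin N → ℝ)).real (closedBall (0 : Fin N → ℝ) R₁) = R ^ N := by
    rw [measureReal_def, Real.volume_pi_closedBall _ hR₁0.le, Fintype.card_fin, ENNReal.toReal_ofReal (by positivity), hR]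
  -- assembling
  calc ‖S (cfgPt x)‖ = (π ^ N)⁻¹ * ‖∫ w, G w‖ := hSx
    _ = (π ^ N)⁻¹ * ‖∫ v : Fin N → ℝ, ∫ u : Fin N → ℝ, G ((reImEquiv N).symm (u, v))‖ := by rw [hiter]
    _ ≤ (π ^ N)⁻¹ * ∫ v : Fin N → ℝ, ‖∫ u : Fin N → ℝ, G ((reImEquiv N).symm (u, v))‖ :=
        mul_le_mul_of_nonneg_left (norm_integral_le_integral_norm _) (by positivity)
    _ ≤ (π ^ N)⁻¹ * ∫ v : Fin N → ℝ, (closedBall (0 : Fin N → ℝ) R₁).indicator (fun _ => GB) v := by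
        refine mul_le_mul_of_nonneg_left ?_ (by positivity)
        exact integral_mono_of_nonneg (ae_of_all _ fun v => norm_nonneg _) hind (ae_of_all _ hinner_bound)
    _ = (π ^ N)⁻¹ * (R ^ N * GB) := by
        rw [integral_indicator_const _ measurableSet_closedBall, hvol, smul_eq_mul]
    _ = _ := by rw [hR, hR₁, hGB]; ring

end Bound

end Literature.MathematicalPhysics.QuantumFieldTheory
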